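import Summits.BirchSwinnertonDyer.BirchSwinnertonDyer.Theorems.ByReductionTypeAtTwoSupersingularFlatColemanClauses
import Literature.NumberTheory.EllipticCurves.Sprung2024.ChromaticLocalInjectivityProofs
import HarnessLib

/-!
# "`r_v` is injective" for Sprung's ♭ condition under EXPLICIT Honda clauses (any `p`) — the `p = 2`
# port, part 2 (the engine of Sprung 2024 §5.2, proof of Lemma 5.5, case `v = p`)

Seat `bsd-2adic-ss-1` GEN 10, crux `SupersingularRankZeroAtTwo` (item stmt-BirchSwinnertonDyer-19097,
route `ByReductionTypeAtTwo`, rung K4), line `signed_halves_two` stub (5) `stub_pmFlatData` — the EC♭@2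
conjunct. Sequel of `Theorems/ByReductionTypeAtTwoSupersingularFlatColemanClauses.lean` (part 1: the ♭
Coleman-kernel algebra without the odd-`p` predicate `Sprung2012.IsHondaSystem`).

WHAT. The K3 lane's kernel engine `Sprung2024.mem_localKerOver_of_layerToInfty_mem_sharpFlatLocalKummerOverOfEmb`
(`Sprung2024/ChromaticLocalInjectivityProofs.lean`: F. Sprung, Adv. Math. 449 (2024) §5.2 p. 40, "We want to show
that the map `H¹(ℚ_p, E[p^∞]) / E(ℚ_p) ⊗ ℚ_p/ℤ_p ⟶(r_p) H¹(ℚ_{p,∞}, E[p^∞]) / E⋆_{∞,p}` is injective …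
The snake lemma thus shows that the left vertical map is surjective. Taking Pontryagin duals, we see that
`r_p` is injective") takes a Honda system in the ODD-`p` form; of it the proof uses only the levels
`c_n ∈ E(K_n·K_v)` and the `n ≥ 1` trace relation (through the existence of Coleman values). This file
re-runs the engine for the colour ♭ with those two clauses as hypotheses, so that it applies at `p = 2`
to the Δ-traced Honda system of Sprung 2012 Thm. 2.2 (2′) (`N = n + 2`), where the odd-`p` bottom
relations fail (`d_0 = [−c♭]ε` is a generator, not `(a₂ − 2)c_{−1}`). Hypotheses displayed: `Col♭` onto
`Λ` (Prop. 7.3's conclusion; produced at `2` in part 3 from the level-`0` generation clause on `d_0`) and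
no `p`-torsion in `E(K_∞·K_v)` (Lemma 2.3, printed for every `p` incl. `2`, §2 p. 1486 "we included the
prime `p = 2`").
HONEST FRAMING: a kernel theorem on the tree's transcription of Sprung's objects with displayed
hypotheses; proof body adapted verbatim from the K3 lane's file (credit: seat `bsd-ssimc-k3c5-kdot-split`
g6); nothing about any curve is asserted; no census cell moves; BSD is not proved by any of this.

References: [Sprung2024] F. Sprung, Adv. Math. 449 (2024) 109741, §5.2 pp. 39–40; [Sprung2012] F. Sprung,
J. Number Theory 132 (2012), Lemma 2.3 (p. 1487), Thm. 2.2 (2′) (p. 1487), Def. 7.1–7.2, Prop. 7.3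
(p. 1500), Def. 7.9, Lemma 7.10 (p. 1503); [Kobayashi2003] Invent. Math. 152 (2003), proof of Prop. 9.2.
-/

set_option autoImplicit false
-- the Theorems namespace of this sub repeats the summit name by design (D-0017 nested layout)
set_option linter.dupNamespace false

noncomputable section

open scoped Classical NumberField

open NumberField IsDedekindDomain Polynomial

universe u

namespace Summit.BirchSwinnertonDyer.BirchSwinnertonDyer.Theorems.SSFlatEC

open Literature.NumberTheory.EllipticCurves Literature.NumberTheory.GaloisRepresentations
  WeierstrassCurve ZpExtension Literature.NumberTheory.EllipticCurves.Kobayashi2003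
  Literature.NumberTheory.EllipticCurves.Sprung2017 Literature.NumberTheory.EllipticCurves.Sprung2012

variable {K : Type u} [Field K] [NumberField K] (W : WeierstrassCurve K) {p : ℕ} [Fact p.Prime]
  (κ : ZpExtension K p) (E : Type u) [Field E] [Algebra K E]

/-! ## §1 Small helpers (copied: private in the source file) -/

/-- The layer subgroups `Gal(K̄/K_n)` are compact. [folklore] -/
private theorem compactSpace_layerSubgroup_aux (n : ℕ) : CompactSpace (κ.layerSubgroup n) := by
  haveI : CompactSpace (Field.absoluteGaloisGroup K) := compactSpace_absoluteGaloisGroup K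
  exact isCompact_iff_compactSpace.mp
    (Subgroup.isClosed_of_isOpen _ (κ.isOpen_layerSubgroup n)).isCompact

omit [NumberField K] in
/-- No `p`-torsion ⟹ no `p`-power torsion in `E(K_∞·K_v)`. [folklore] -/
private theorem eq_zero_of_pow_smul_eq_zero
    {ι : AlgebraicClosure K →ₐ[K] AlgebraicClosure E}
    (hnt : ∀ P ∈ localTowerPointsOfEmb κ ι W, p • P = 0 → P = 0)
    {m : ℕ} {P : localPoints W E} (hP : P ∈ localTowerPointsOfEmb κ ι W) (h : p ^ m • P = 0) :
    P = 0 := by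
  induction m generalizing P with
  | zero => rwa [pow_zero, one_smul] at h
  | succ m ih =>
    have h1 : p ^ m • P ∈ localTowerPointsOfEmb κ ι W := AddSubgroup.nsmul_mem _ hP _
    have h2 : p • (p ^ m • P) = 0 := by rw [← mul_smul, ← pow_succ']; exact h
    exact ih hP (hnt _ h1 h2)

omit [NumberField K] in
/-- A Galois element commutes with multiplication by `n` on local points. [folklore] -/
private theorem galois_smul_nsmul (τ : Field.absoluteGaloisGroup E) (n : ℕ) (P : localPoints W E) :
    τ • (n • P) = n • (τ • P) :=
  map_nsmul (DistribSMul.toAddMonoidHom (localPoints W E) τ) n P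

/-! ## §2 The engine, colour ♭, explicit Honda clauses -/

/-- **Sprung 2024, Lemma 5.5 case `v = p` ("`r_p` is injective"), colour ♭, under EXPLICIT Honda
clauses, any `p`.** Let `K` be a number field, `E/K` elliptic, `K_v` a completion (`E` below,
`ι = closureEmb`), `κ` a `ℤ_p`-extension, `g ∈ Γ_{K_v}` restricting to a topological generator,
`c = (c_n)` local points with `c_n ∈ E(K_n·K_v)` and `Tr_{n+1/n} c_{n+1} = ap·c_n − c_{n−1}` (`n ≥ 1`),
`p ∣ ap`. ASSUME (i) `Col♭` is onto `Λ` (`hsurj`, Sprung 2012 Prop. 7.3's conclusion shape) and (ii)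
`E(K_∞·K_v)` has no `p`-torsion (`hnt`, Lemma 2.3). THEN every `y ∈ H¹(K, E[p^∞])` whose restriction
to `K_∞` satisfies the ♭-condition at `𝔭` satisfies the classical local condition at `v`. This is the
body of the K3 lane's engine `Sprung2024.mem_localKerOver_of_layerToInfty_mem_sharpFlatLocalKummerOverOfEmb`
(seat `bsd-ssimc-k3c5-kdot-split` g6), line by line, with the odd-`p` Honda predicate replaced by the
two clauses its proof uses (step 3 now by `SSFlatEC.exists_mem_colemanKer_flat_add_twist`); steps:
(1) unpack the ♭-condition and absorb the coboundary; (2) `w₀ := gQ − Q − Φ(g)` is `G_∞`-fixed,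
`g x − x = p^k w₀`; (3) every functional on `M = E(K_∞·K_v)` killing `E(K_v)` is divisible by `p^k`
at `x`; (4) Pontryagin separation in `M/E(K_v)` (torsion-free by (ii)); (5) descent.
[cite: Sprung2024, §5.2 proof of Lemma 5.5, case v = p (p. 40)] [cite: Kobayashi2003, proof of Prop. 9.2]
[cite: Sprung2012, Prop. 7.3 (p. 1500), Lemma 2.3 (p. 1487), Def. 7.9 (p. 1503)] -/
theorem mem_localKerOver_of_layerToInfty_mem_flatLocalKummer {ap : ℤ}
    (hap : (p : ℤ) ∣ ap) {g : Field.absoluteGaloisGroup E}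
    (hg : κ.IsTopGenerator (resGalOfEmb (closureEmb (K := K) E) g))
    {c : ℕ → localPoints W E}
    (hc : ∀ n, c n ∈ localLayerPointsOfEmb κ (closureEmb (K := K) E) W n)
    (hTr : ∀ n, 1 ≤ n → localTraceOfEmb κ (closureEmb (K := K) E) W n (n + 1) (c (n + 1)) =
      ap • c n - c (n - 1))
    (hsurj : ∀ f : IwasawaAlgebra p,
      ∃ (w : localTowerPointsOfEmb κ (closureEmb (K := K) E) W →+ ℤ_[p]) (Ls : IwasawaAlgebra p),
        IsColemanPair κ (closureEmb (K := K) E) W ap g c w Ls f)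
    (hnt : ∀ P ∈ localTowerPointsOfEmb κ (closureEmb (K := K) E) W, p • P = 0 → P = 0)
    {y : W.subgroupH1 p (κ.layerSubgroup 0)}
    (hy : W.layerToInfty κ 0 y ∈ sharpFlatLocalKummerOverOfEmb W p κ.kerSubgroup
        (closureEmb (K := K) E) (localTowerPointsOfEmb κ (closureEmb (K := K) E) W)
        (colemanKer κ (closureEmb (K := K) E) W ap g c Chroma.flat)) :
    y ∈ W.localKerOver p (κ.layerSubgroup 0) E := by
  -- notation
  set ι : AlgebraicClosure K →ₐ[K] AlgebraicClosure E := closureEmb (K := K) E with hι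
  set M : AddSubgroup (localPoints W E) := localTowerPointsOfEmb κ ι W with hM
  haveI : CompactSpace (κ.layerSubgroup 0) := compactSpace_layerSubgroup_aux κ 0
  have hle0 : localLayerPointsOfEmb κ ι W 0 ≤ M := localLayerPointsOfEmb_le_localTowerPointsOfEmb κ ι W 0
  have hmem0 : ∀ σ : Field.absoluteGaloisGroup E, resGalOfEmb ι σ ∈ κ.layerSubgroup 0 := fun σ ↦ by
    rw [ZpExtension.layerSubgroup_zero]; exact Subgroup.mem_top _
  have hM0 : ∀ {P : localPoints W E}, P ∈ localLayerPointsOfEmb κ ι W 0 ↔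
      ∀ τ : Field.absoluteGaloisGroup E, τ • P = P := fun {P} ↦ mem_localLayerPointsOfEmb_zero_iff κ ι W P
  have hMfix : ∀ {P : localPoints W E}, P ∈ M →
      ∀ τ : Field.absoluteGaloisGroup E, τ ∈ localSubgroupOfEmb κ.kerSubgroup ι → τ • P = P :=
    fun {P} hP ↦ (mem_localTowerPointsOfEmb_iff κ ι W P).1 hP
  have hMsmul : ∀ (σ : Field.absoluteGaloisGroup E) {P : localPoints W E}, P ∈ M → σ • P ∈ M :=
    fun σ {P} hP ↦ smul_mem_localTowerPointsOfEmb κ ι W σ hP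
  -- normality of `G_∞ = localSubgroupOfEmb (ker κ) ι` in `Γ_{K_v}`
  have hconj : ∀ (σ τ : Field.absoluteGaloisGroup E), τ ∈ localSubgroupOfEmb κ.kerSubgroup ι →
      σ⁻¹ * τ * σ ∈ localSubgroupOfEmb κ.kerSubgroup ι := by
    intro σ τ hτ
    rw [mem_localSubgroupOfEmb_iff] at hτ ⊢
    rw [map_mul, map_mul, map_inv]
    exact κ.kerSubgroup_normal.conj_mem' _ hτ _
  -- Step 0: a cocycle `Φ` for `y` and its local values `f σ = ι_* Φ(res σ)`
  obtain ⟨Φ, rfl⟩ := oneCocycleClass_surjective (discreteTopRep (κ.layerSubgroup 0) (W.geomPrimaryTorsion p)) y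
  set f : Field.absoluteGaloisGroup E → localPoints W E := fun σ ↦
    pointsMapOfEmb W ι ((Φ.1 ⟨resGalOfEmb ι σ, hmem0 σ⟩ : W.geomPrimaryTorsion p) : W.geomPoints)
    with hf
  -- cocycle identity for `f`
  have hfmul : ∀ σ τ : Field.absoluteGaloisGroup E, f (σ * τ) = f σ + σ • f τ := by
    intro σ τ
    have hst : (⟨resGalOfEmb ι (σ * τ), hmem0 (σ * τ)⟩ : κ.layerSubgroup 0) =
        ⟨resGalOfEmb ι σ, hmem0 σ⟩ * ⟨resGalOfEmb ι τ, hmem0 τ⟩ := Subtype.ext (map_mul _ _ _)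
    have h := Φ.2 ⟨resGalOfEmb ι σ, hmem0 σ⟩ ⟨resGalOfEmb ι τ, hmem0 τ⟩
    simp only [hf]
    rw [hst, h, AddSubgroup.coe_add, map_add, discreteTopRep_ρ_apply, Subgroup.smul_def,
      primaryComponent.coe_smul, pointsMapOfEmb_smul]
  -- a uniform power of `p` killing `Φ` (compactness), hence `f`
  have hΦtors : ∀ h : κ.layerSubgroup 0, ∃ k : ℕ, p ^ k • Φ.1 h = 0 := fun h ↦ by
    obtain ⟨k, hk⟩ := AddCommGroup.mem_primaryComponent.mp (Φ.1 h).2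
    exact ⟨k, Subtype.ext (by rw [AddSubmonoidClass.coe_nsmul, hk, ZeroMemClass.coe_zero])⟩
  obtain ⟨N, hN⟩ := exists_pow_smul_apply_eq_zero Φ.1 hΦtors
  have hfN : ∀ σ : Field.absoluteGaloisGroup E, p ^ N • f σ = 0 := by
    intro σ
    simp only [hf]
    rw [← map_nsmul, ← AddSubmonoidClass.coe_nsmul, hN, ZeroMemClass.coe_zero, map_zero]
  -- Step 1: unpack the ⋆-condition and absorb the coboundary between the two representatives
  obtain ⟨φ, Q, k, hQM, hφ, hdiv, hcob⟩ := hy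
  have hres : W.layerToInfty κ 0 (oneCocycleClass _ Φ) =
      oneCocycleClass _ (contOneCocycles.pullback (subgroupInclusion (κ.kerSubgroup_le_layerSubgroup 0))
        (resHomOfEquivariant (subgroupInclusion (κ.kerSubgroup_le_layerSubgroup 0))
          (AddMonoidHom.id (W.geomPrimaryTorsion p)) (fun _ _ ↦ rfl)) Φ) :=
    map_oneCocycleClass _ _ _ Φ
  rw [hres, ← sub_eq_zero, ← oneCocycleClass_sub, oneCocycleClass_eq_zero_iff] at hφ
  obtain ⟨R₀, hR₀⟩ := hφ
  -- `φ h = Φ h + (h R₀ − R₀)` for `h ∈ ker κ`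
  have hφΦ : ∀ h : κ.kerSubgroup, (φ.1 h : W.geomPrimaryTorsion p) =
      Φ.1 ⟨(h : Field.absoluteGaloisGroup K), κ.kerSubgroup_le_layerSubgroup 0 h.2⟩ +
        ((h : Field.absoluteGaloisGroup K) • R₀ - R₀) := by
    intro h
    have hpb : (contOneCocycles.pullback (subgroupInclusion (κ.kerSubgroup_le_layerSubgroup 0))
        (resHomOfEquivariant (subgroupInclusion (κ.kerSubgroup_le_layerSubgroup 0))
          (AddMonoidHom.id (W.geomPrimaryTorsion p)) (fun _ _ ↦ rfl)) Φ).1 h =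
        Φ.1 ⟨(h : Field.absoluteGaloisGroup K), κ.kerSubgroup_le_layerSubgroup 0 h.2⟩ := by
      rw [contOneCocycles.pullback_apply]; rfl
    have h1 := hR₀ h
    rw [Submodule.coe_sub, ContinuousMap.sub_apply, hpb, sub_eq_iff_eq_add, discreteTopRep_ρ_apply,
      Subgroup.smul_def] at h1
    rw [h1, add_comm]
  -- a power of `p` killing `R₀`
  obtain ⟨m₀, hm₀⟩ : ∃ m₀ : ℕ, p ^ m₀ • R₀ = 0 := by
    obtain ⟨m, hm⟩ := AddCommGroup.mem_primaryComponent.mp R₀.2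
    exact ⟨m, Subtype.ext (by rw [AddSubmonoidClass.coe_nsmul, hm, ZeroMemClass.coe_zero])⟩
  -- the corrected point `Q₁`, exponent `k' = k + m₀`, `x' = p^{k'} Q₁ = p^{m₀} x ∈ M`
  set R₀' : localPoints W E := pointsMapOfEmb W ι ((R₀ : W.geomPrimaryTorsion p) : W.geomPoints) with hR₀'
  have hR₀'tors : p ^ m₀ • R₀' = 0 := by
    rw [hR₀', ← map_nsmul, ← AddSubmonoidClass.coe_nsmul, hm₀, ZeroMemClass.coe_zero, map_zero]
  set Q₁ : localPoints W E := Q - R₀' with hQ₁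
  set k' : ℕ := k + m₀ with hk'
  set x' : localPoints W E := p ^ k' • Q₁ with hx'
  have hx'eq : x' = p ^ m₀ • (p ^ k • Q) := by
    have e1 : p ^ k' • R₀' = 0 := by rw [hk', pow_add, mul_smul, hR₀'tors, smul_zero]
    rw [hx', hQ₁, smul_sub, e1, sub_zero, hk', pow_add, mul_comm, mul_smul]
  have hx'M : x' ∈ M := by rw [hx'eq]; exact AddSubgroup.nsmul_mem _ hQM _
  -- `f τ = τ Q₁ − Q₁` on `G_∞`
  have hfcob : ∀ τ : Field.absoluteGaloisGroup E, τ ∈ localSubgroupOfEmb κ.kerSubgroup ι →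
      f τ = τ • Q₁ - Q₁ := by
    intro τ hτ
    have h1 := hcob ⟨τ, hτ⟩
    change pointsMapOfEmb W ι _ = τ • Q - Q at h1
    have h2 := hφΦ (resGalSubgroupOfEmb κ.kerSubgroup ι ⟨τ, hτ⟩)
    have h3 : f τ = pointsMapOfEmb W ι ((Φ.1
        ⟨((resGalSubgroupOfEmb κ.kerSubgroup ι ⟨τ, hτ⟩ : κ.kerSubgroup) : Field.absoluteGaloisGroup K),
          κ.kerSubgroup_le_layerSubgroup 0 (resGalSubgroupOfEmb κ.kerSubgroup ι ⟨τ, hτ⟩).2⟩ :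
        W.geomPrimaryTorsion p) : W.geomPoints) := rfl
    have h4 : Φ.1 ⟨((resGalSubgroupOfEmb κ.kerSubgroup ι ⟨τ, hτ⟩ : κ.kerSubgroup) :
          Field.absoluteGaloisGroup K),
          κ.kerSubgroup_le_layerSubgroup 0 (resGalSubgroupOfEmb κ.kerSubgroup ι ⟨τ, hτ⟩).2⟩ =
        φ.1 (resGalSubgroupOfEmb κ.kerSubgroup ι ⟨τ, hτ⟩) -
          (((resGalSubgroupOfEmb κ.kerSubgroup ι ⟨τ, hτ⟩ : κ.kerSubgroup) :
            Field.absoluteGaloisGroup K) • R₀ - R₀) := by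
      rw [h2]; abel
    rw [h3, h4, AddSubgroup.coe_sub, map_sub, h1, AddSubgroup.coe_sub, map_sub,
      primaryComponent.coe_smul, resGalSubgroupOfEmb_apply_coe, pointsMapOfEmb_smul, hQ₁, smul_sub]
    abel
  -- divisibility hypothesis transported to `x'`
  have hdiv' : ∀ z ∈ colemanKer κ ι W ap g c Chroma.flat, (p : ℤ_[p]) ^ k' ∣ z ⟨x', hx'M⟩ := by
    intro z hz
    have h1 : (⟨x', hx'M⟩ : M) = p ^ m₀ • ⟨p ^ k • Q, hQM⟩ := Subtype.ext (by
      rw [AddSubmonoidClass.coe_nsmul]; exact hx'eq)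
    rw [h1, map_nsmul, nsmul_eq_mul, Nat.cast_pow, hk', pow_add, mul_comm ((p : ℤ_[p]) ^ k)]
    exact mul_dvd_mul_left _ (hdiv z hz)
  -- Step 2: invariance — `w₀ := g Q₁ − Q₁ − f g ∈ M` and `g x' − x' = p^{k'} w₀`
  set w₀ : localPoints W E := g • Q₁ - Q₁ - f g with hw₀
  have hw₀M : w₀ ∈ M := by
    rw [hM, mem_localTowerPointsOfEmb_iff]
    intro τ hτ
    have hτ' := hconj g τ hτ
    -- `f (τ g) = f τ + τ f g` and `τ g = g (g⁻¹ τ g)`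
    have e1 : f (τ * g) = f τ + τ • f g := hfmul τ g
    have e2 : f (τ * g) = f g + g • f (g⁻¹ * τ * g) := by
      rw [show τ * g = g * (g⁻¹ * τ * g) by group]; exact hfmul g _
    rw [hfcob τ hτ] at e1
    rw [hfcob _ hτ', smul_sub, ← mul_smul, show g * (g⁻¹ * τ * g) = τ * g by group, mul_smul] at e2
    -- `τ Q₁ − Q₁ + τ f g = f g + (τ g Q₁ − g Q₁)`
    have key := e1.symm.trans e2
    rw [smul_sub, smul_sub]
    calc τ • g • Q₁ - τ • Q₁ - τ • f g
        = τ • g • Q₁ - (τ • Q₁ - Q₁ + τ • f g) - Q₁ := by abel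
      _ = τ • g • Q₁ - (f g + (τ • g • Q₁ - g • Q₁)) - Q₁ := by rw [key]
      _ = g • Q₁ - Q₁ - f g := by abel
  have hgx' : g • x' - x' = p ^ k' • w₀ := by
    -- `p^{k'} w₀ = g x' − x' − p^{k'} f g`, and `p^{k'} f g ∈ M` is `p`-power torsion, hence `0`
    have e1 : p ^ k' • w₀ = g • x' - x' - p ^ k' • f g := by
      rw [hw₀, smul_sub, smul_sub, hx', galois_smul_nsmul]
    have htM : p ^ k' • f g ∈ M := by
      have : p ^ k' • f g = g • x' - x' - p ^ k' • w₀ := by rw [e1]; abel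
      rw [this]
      exact sub_mem (sub_mem (hMsmul g hx'M) hx'M) (AddSubgroup.nsmul_mem _ hw₀M _)
    have ht0 : p ^ k' • f g = 0 :=
      eq_zero_of_pow_smul_eq_zero W κ E hnt htM (m := N) (by rw [smul_comm, hfN, smul_zero])
    rw [e1, ht0, sub_zero]
  -- Step 3: every functional on `M` vanishing on `E(K_v)` is divisible by `p^{k'}` at `x'`
  have hdivAnn : ∀ z : M →+ ℤ_[p], (∀ (x : localPoints W E) (hx : x ∈ localLayerPointsOfEmb κ ι W 0),
      z ⟨x, hle0 hx⟩ = 0) → (p : ℤ_[p]) ^ k' ∣ z ⟨x', hx'M⟩ := by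
    intro z hz0
    obtain ⟨z₁, w, hz₁, hzw⟩ :=
      SSFlatEC.exists_mem_colemanKer_flat_add_twist hap hg hc hTr hsurj hz0
    rw [hzw ⟨x', hx'M⟩]
    refine dvd_add (hdiv' z₁ hz₁) ?_
    -- `w(g⁻¹ x') − w(x') = w(g⁻¹ x' − x') = −p^{k'} w(g⁻¹ w₀)`
    have e1 : g⁻¹ • x' - x' = -(p ^ k' • (g⁻¹ • w₀)) := by
      rw [← galois_smul_nsmul, ← hgx', smul_sub, inv_smul_smul]; abel
    have e2 : ∀ h1 : g⁻¹ • x' ∈ M, (⟨g⁻¹ • x', h1⟩ : M) - ⟨x', hx'M⟩ =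
        -(p ^ k' • ⟨g⁻¹ • w₀, hMsmul g⁻¹ hw₀M⟩) := fun h1 ↦ Subtype.ext (by
      rw [AddSubgroup.coe_sub, AddSubgroup.coe_neg, AddSubmonoidClass.coe_nsmul]; exact e1)
    change (p : ℤ_[p]) ^ k' ∣ w ⟨g⁻¹ • x', _⟩ - w ⟨x', hx'M⟩
    rw [← map_sub, e2, map_neg, map_nsmul, nsmul_eq_mul, Nat.cast_pow]
    exact (dvd_neg).mpr (dvd_mul_right _ _)
  -- Step 4: Pontryagin separation in `M / E(K_v)` — `x' = p^{k'} R + x₀`, `x₀ ∈ E(K_v)`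
  set M₀' : AddSubgroup M := (localLayerPointsOfEmb κ ι W 0).addSubgroupOf M with hM₀'
  have hM₀'mem : ∀ {m : M}, m ∈ M₀' ↔ (m : localPoints W E) ∈ localLayerPointsOfEmb κ ι W 0 :=
    fun {m} ↦ AddSubgroup.mem_addSubgroupOf
  have hNtf : ∀ n : M ⧸ M₀', p • n = 0 → n = 0 := by
    intro n hn
    induction n using QuotientAddGroup.induction_on with
    | H m =>
      rw [← QuotientAddGroup.mk_nsmul, QuotientAddGroup.eq_zero_iff, hM₀'mem, hM0] at hn
      rw [QuotientAddGroup.eq_zero_iff, hM₀'mem, hM0]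
      intro τ
      have hd : τ • (m : localPoints W E) - m ∈ M := sub_mem (hMsmul τ m.2) m.2
      have hpd : p • (τ • (m : localPoints W E) - m) = 0 := by
        rw [smul_sub, ← galois_smul_nsmul, ← AddSubmonoidClass.coe_nsmul, hn τ, sub_self]
      exact sub_eq_zero.mp (hnt _ hd hpd)
  have hsep : ∀ z' : M ⧸ M₀' →+ ℤ_[p], (p : ℤ_[p]) ^ k' ∣ z' (QuotientAddGroup.mk ⟨x', hx'M⟩) := by
    intro z'
    have h := hdivAnn (z'.comp (QuotientAddGroup.mk' M₀')) (fun x hx ↦ by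
      rw [AddMonoidHom.comp_apply, QuotientAddGroup.mk'_apply,
        (QuotientAddGroup.eq_zero_iff _).mpr (hM₀'mem.mpr hx), map_zero])
    exact h
  obtain ⟨yq, hyq⟩ := Literature.Algebra.Module.exists_nsmul_eq_of_forall_addMonoidHom_padicInt_dvd hNtf hsep
  obtain ⟨R, rfl⟩ := QuotientAddGroup.mk_surjective yq
  rw [← QuotientAddGroup.mk_nsmul, QuotientAddGroup.eq, hM₀'mem] at hyq
  -- `x₀ := −p^{k'} R + x' ∈ E(K_v)`
  set x₀ : localPoints W E := -(p ^ k' • (R : localPoints W E)) + x' with hx₀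
  have hx₀0 : x₀ ∈ localLayerPointsOfEmb κ ι W 0 := by
    have : ((-(p ^ k' • R) + ⟨x', hx'M⟩ : M) : localPoints W E) = x₀ := by
      rw [AddSubgroup.coe_add, AddSubgroup.coe_neg, AddSubmonoidClass.coe_nsmul]
    rw [← this]; exact hyq
  -- Step 5: descent — `Q' := Q₁ − R`, `p^{k'} Q' = x₀`, and `f = ∂Q'` on all of `Γ_{K_v}`
  set Q' : localPoints W E := Q₁ - R with hQ'
  have hQ'k : p ^ k' • Q' = x₀ := by rw [hQ', smul_sub, ← hx', hx₀]; abel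
  have hfcob' : ∀ τ : Field.absoluteGaloisGroup E, τ ∈ localSubgroupOfEmb κ.kerSubgroup ι →
      f τ = τ • Q' - Q' := by
    intro τ hτ
    rw [hfcob τ hτ, hQ', smul_sub τ Q₁ (R : localPoints W E), hMfix R.2 τ hτ]
    abel
  have hfall : ∀ σ : Field.absoluteGaloisGroup E, f σ = σ • Q' - Q' := by
    intro σ
    -- `ψ := f σ − (σ Q' − Q')` is `G_∞`-fixed …
    have hψM : f σ - (σ • Q' - Q') ∈ M := by
      rw [hM, mem_localTowerPointsOfEmb_iff]
      intro τ hτ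
      have hτ' := hconj σ τ hτ
      have e1 : f (τ * σ) = f τ + τ • f σ := hfmul τ σ
      have e2 : f (τ * σ) = f σ + σ • f (σ⁻¹ * τ * σ) := by
        rw [show τ * σ = σ * (σ⁻¹ * τ * σ) by group]; exact hfmul σ _
      rw [hfcob' τ hτ] at e1
      rw [hfcob' _ hτ', smul_sub, ← mul_smul, show σ * (σ⁻¹ * τ * σ) = τ * σ by group, mul_smul] at e2
      have key := e1.symm.trans e2
      rw [smul_sub, smul_sub]
      calc τ • f σ - (τ • σ • Q' - τ • Q')
          = (τ • Q' - Q' + τ • f σ) - τ • σ • Q' + Q' := by abel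
        _ = (f σ + (τ • σ • Q' - σ • Q')) - τ • σ • Q' + Q' := by rw [key]
        _ = f σ - (σ • Q' - Q') := by abel
    -- … and `p`-power torsion: `p^{k'} ψ = p^{k'} f σ` (as `σ x₀ = x₀`), killed by `p^N`
    have hψtors : p ^ (N + k') • (f σ - (σ • Q' - Q')) = 0 := by
      have e1 : p ^ k' • (f σ - (σ • Q' - Q')) = p ^ k' • f σ := by
        rw [smul_sub, smul_sub, ← galois_smul_nsmul, hQ'k, (hM0.mp hx₀0) σ, sub_self, sub_zero]
      rw [pow_add, mul_smul, e1, smul_comm, hfN, smul_zero]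
    exact sub_eq_zero.mp (eq_zero_of_pow_smul_eq_zero W κ E hnt hψM hψtors)
  -- conclusion: `loc_v y` is the coboundary of `Q'`
  show oneCocycleClass _ Φ ∈ W.localKerOverOfEmb p (κ.layerSubgroup 0) ι
  refine localKummerOverOfEmb_le_localKerOverOfEmb (localLayerPointsOfEmb κ ι W 0) ⟨Φ, Q', k', rfl,
    by rw [hQ'k]; exact hx₀0, fun τ ↦ ?_⟩
  exact hfall τ
end Summit.BirchSwinnertonDyer.BirchSwinnertonDyer.Theorems.SSFlatEC

end
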